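import Summits.AtomisticToContinuum.Crystallization.Theorems.FrustratedLawDichotomyGSCClusterExactness

/-!
# FrustratedLawDichotomy · crux `AperiodicFrustratedLawGap` (stmt-AtomisticToContinuum-27623) — THE `e⋆`-FREE SURGERY TEST
# (census form of cluster exactness; route-independent module; decomp-a2c, prover hand 2, structural share, generation 6)

For censuses of the law-free residual (`R_GSC^aper ⟺ R_selfVH^aper`, `FrustratedLawDichotomyGSCSelfConsistentDoorExact`): a candidate
configuration `X` given together with ANY van Hove family of finite clusters `C_j = xf_j(Fin n_j) ⊆ X` (`I(C_j, X∖C_j)/n_j → 0`) whose energy per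
atom tends to a number `μc` (the candidate's own energy density — computable from patch frequencies of a quasicrystal model or from `e(Q)` of a
periodic approximant) is EXCLUDED as an `e⋆`-μ-ground-state configuration of Lennard-Jones by ANY finite surgery «remove `m` atoms `yf`, insert
`k` atoms `R`» whose balance is `< μc·(k − m)` — insertions (`k > m`) included, and with NO bound on `e⋆` from either side:

* `energyDensity_eq_eStar`                  : `IsMuGSC V_LJ e⋆ X` and a van Hove family with `U(C_j)/n_j → μc` force `μc = e⋆`
  (`FrustratedLawDichotomyGSCClusterExactness.tendsto_energyPerAtom` + uniqueness of limits);
* `not_isMuGSC_eStar_of_surgery_at_density` : the test.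

All `[folklore]`.
-/

noncomputable section

namespace Summit.AtomisticToContinuum.Crystallization.Theorems.FrustratedLawDichotomyGSCDensitySurgeryTest

open Filter Topology
open Literature.MathematicalPhysics.StatisticalMechanics
open Summit.AtomisticToContinuum.Crystallization.Theorems.ChargedEnergyGapNegative (E3 eStar)
open Summit.AtomisticToContinuum.Crystallization.Theorems.FrustratedLawDichotomyGSCClusterExactness (tendsto_energyPerAtom)

variable {X : Set E3} {ι : Type*} {l : Filter ι}

/-- **The energy density of an `e⋆`-μGSC along any van Hove family is `e⋆`**: if `U(C_j)/n_j → μc` then `μc = e⋆`. [folklore] -/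
theorem energyDensity_eq_eStar [l.NeBot] (h : IsMuGSC lennardJones eStar X) (n : ι → ℕ) (xf : ∀ j, Fin (n j) → E3)
    (hinj : ∀ j, Function.Injective (xf j)) (hX : ∀ j, Set.range (xf j) ⊆ X) (hnpos : ∀ j, 0 < n j)
    (hI : Tendsto (fun j => (∑ i, ∑' y : ↥(X \ Set.range (xf j)), lennardJones (dist (xf j i) y)) / (n j : ℝ)) l (𝓝 0))
    {μc : ℝ} (hU : Tendsto (fun j => interactionEnergy lennardJones (xf j) / (n j : ℝ)) l (𝓝 μc)) :
    μc = eStar :=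
  tendsto_nhds_unique hU (tendsto_energyPerAtom h n xf hinj hX hnpos hI)

/-- **THE `e⋆`-FREE SURGERY TEST.**  Let `X ⊆ ℝ³` carry a van Hove family of finite clusters with energy per atom `→ μc`.  If some finite
surgery — remove the `m` distinct atoms `yf ⊆ X`, insert the `k` distinct atoms `R` off `X ∖ yf` — has balance
`[U(R) + I(R, X∖yf)] − [U(yf) + I(yf, X∖yf)] < μc·(k − m)`, then `X` is NOT an `e⋆`-μ-ground-state configuration of `V_LJ`.
(Were it one, `μc = e⋆` by `energyDensity_eq_eStar`, and Sütő's stability at `μ = e⋆` would forbid the surgery.) [folklore] -/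
theorem not_isMuGSC_eStar_of_surgery_at_density [l.NeBot] (n : ι → ℕ) (xf : ∀ j, Fin (n j) → E3)
    (hinj : ∀ j, Function.Injective (xf j)) (hX : ∀ j, Set.range (xf j) ⊆ X) (hnpos : ∀ j, 0 < n j)
    (hI : Tendsto (fun j => (∑ i, ∑' y : ↥(X \ Set.range (xf j)), lennardJones (dist (xf j i) y)) / (n j : ℝ)) l (𝓝 0))
    {μc : ℝ} (hU : Tendsto (fun j => interactionEnergy lennardJones (xf j) / (n j : ℝ)) l (𝓝 μc))
    {m : ℕ} {yf : Fin m → E3} (hyf : Function.Injective yf) (hY : Set.range yf ⊆ X)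
    {k : ℕ} {R : Fin k → E3} (hR : Function.Injective R) (hdisj : Disjoint (Set.range R) (X \ Set.range yf))
    (hΔ : (interactionEnergy lennardJones R + ∑ i, ∑' y : ↥(X \ Set.range yf), lennardJones (dist (R i) y)) -
        (interactionEnergy lennardJones yf + ∑ i, ∑' y : ↥(X \ Set.range yf), lennardJones (dist (yf i) y)) < μc * ((k : ℝ) - m)) :
    ¬ IsMuGSC lennardJones eStar X := by
  intro h
  have hμ : μc = eStar := energyDensity_eq_eStar h n xf hinj hX hnpos hI hU
  have key := h.le hyf hY hR hdisj
  rw [hμ] at hΔ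
  have : eStar * ((k : ℝ) - m) = eStar * k - eStar * m := by ring
  linarith

/-- **The same test against a μGSC at the candidate's density directly** (no `e⋆` at all): a surgery with balance `< μc·(k − m)` refutes
`IsMuGSC V_LJ μc X` — Sütő's stability, contrapositive (stated here so that the route-independent census module is self-contained). [folklore] -/
theorem not_isMuGSC_of_surgery {μc : ℝ} {m : ℕ} {yf : Fin m → E3} (hyf : Function.Injective yf) (hY : Set.range yf ⊆ X)
    {k : ℕ} {R : Fin k → E3} (hR : Function.Injective R) (hdisj : Disjoint (Set.range R) (X \ Set.range yf))
    (hΔ : (interactionEnergy lennardJones R + ∑ i, ∑' y : ↥(X \ Set.range yf), lennardJones (dist (R i) y)) -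
        (interactionEnergy lennardJones yf + ∑ i, ∑' y : ↥(X \ Set.range yf), lennardJones (dist (yf i) y)) < μc * ((k : ℝ) - m)) :
    ¬ IsMuGSC lennardJones μc X := by
  intro h
  have key := h.le hyf hY hR hdisj
  have : μc * ((k : ℝ) - m) = μc * k - μc * m := by ring
  linarith

end Summit.AtomisticToContinuum.Crystallization.Theorems.FrustratedLawDichotomyGSCDensitySurgeryTest

end
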